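import Summits.HodgeConjecture.HodgeConjecture.Theorems.F0P3LettersOfClassificationShapeRigid   -- ★ p814530: (C3₀) ⇒ (C2), (C3₀)+U♭ ⇒ (C3); imports ★ p814159 + letters + D6
import Literature.NumberTheory.Automorphic.HeckeEigencharacterPackage                         -- ★ p816113 (D9): `IrrClass.IsSphericalWith`, `IrrClass.eq_of_isSphericalWith`
import Summits.HodgeConjecture.HodgeConjecture.Theorems.F0P3SeparationLemmaOfBounded            -- ★ p816508 (F0P4-p02): `separationLemma_of_injective_bounded_starClosed` (⇒ ★ p816018 B1 `SeparationLemma`, `regroup_by_evp`; ★ p816337)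
import Literature.NumberTheory.Automorphic.HilbertRepOrthogonalDecomposition                  -- ★ `ContRepresentation.le_multiplicity_of_pairwise_isOrtho` (glue `one_le_multiplicity`)
import Literature.NumberTheory.Automorphic.SmoothCharacterUnitaryBound                       -- ★ p817229 (F0P4-p02, (L1-ii)): `IrrClass.IsSphericalWith.norm_apply_le_inv_mul_integral_norm` (+ ★ p816767 `IrrClass.IsUnitarizable`)
import Literature.RepresentationTheory.GKModuleIrrClass                                  -- ★ p816930 (typ3): `GKIrrClass`, `GKIrrClass.ofModule` (v3: the archimedean class type is ★ currency)
import HarnessLib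

/-!
# `F0P3ClassificationKit` (T5-A): the frame, e.v.p. germs off `S`, the sockets and the CLASSIFICATION KIT of posited carriers, its PINS — Rogawski pp. 236–239 in T1 style

Theorems rendering (F0P3-plan (g4) RULINGS (V9)(b)∕(V12), F0P3-p03 (g6)) of the T5 statement layer = dossier line
`Cruxes/H413/Lines/F0_T5InnerFormClassification.lean` (v3.1 c06f45df; PLAN.F0P3g4 §22–§25), split by topic into four ★-importable modules sharing the
namespace `…Cruxes.H413.F0P3InnerFormClassification` (Theorems never import Lines): (A) `F0P3ClassificationKit` — frame, e.v.p. germs, the kit, pins;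
(B) `F0P3ClassificationLaws` — the named laws and the intermediate statements (14.6.2) ∕ coefficient formula; (C) `F0P3ClassificationEngine` — the
integrator's own mathematics Z3∕Z2∕Z10a, PROVED; (D) `F0P3InnerFormClassification` — glue, the head `shape_of_T5`, the kit-family composition
`shapeGuarded_of_T5`.  Declarations and proofs are BYTE-IDENTICAL to the dossier text; only module docstrings, the namespace name, a few one-line
docstrings (Theorems lint) and the re-emitted `variable` blocks differ.  No `sorry`, no named fact, no instance, no notation.

THIS MODULE: §0 frame abbreviations, `EvpData`∕`EqOff`∕`Germ`, `HasToken`, `one_le_multiplicity`; §1 `Sockets`, `structure ClassificationKit` (DATA ONLY), §1.1 derived notation, §1.2 `IsPinned`.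
HONEST LABEL: HC_CM is proved only modulo the printed citations until rung 0 closes.
-/

attribute [local instance 100] LieRing.ofAssociativeRing

set_option autoImplicit false
set_option linter.dupNamespace false

noncomputable section

open NumberField IsDedekindDomain MeasureTheory
open scoped Matrix ComplexOrder BigOperators Classical

namespace Summit.HodgeConjecture.HodgeConjecture.Cruxes.H413.F0P3InnerFormClassification

open Literature.NumberTheory.Rogawski1990 Literature.NumberTheory.GaloisRepresentations
open Literature.NumberTheory.Automorphic Literature.NumberTheory.Automorphic.UnitaryGroup
open Literature.NumberTheory.Automorphic.UnitaryGroup.CotangentForms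
open Literature.RepresentationTheory.BorelWallach2000
open Literature.RepresentationTheory.KonnoKonno2007

/-! ## §0 Frame abbreviations and the e.v.p. currency (D9, CONCRETE) -/

variable (L : Type) [Field L] [NumberField L] [IsCMField L]

/-- `G′ = U(H)` over `L⁺` as adelic group datum (★; `= UnitaryGroup.cmDatum L 3 H` by `rfl`). -/
abbrev Gp (H : Matrix (Fin 3) (Fin 3) L) := adelicGroupData (↥(maximalRealSubfield L)) L (IsCMField.complexConj L) 3 H

/-- `Φ_N`, the quasi-split form (★ `qsForm` for `N = 3`; T1's `splitForm`). -/
abbrev splitForm (N : ℕ) : Matrix (Fin N) (Fin N) L := Matrix.of fun i j : Fin N => if i.val + j.val + 1 = N then (1 : L) else 0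

/-- `C_c(G′(𝔸))` (T1's `TestGp`). -/
abbrev TestGp (H : Matrix (Fin 3) (Fin 3) L) : Type := CompactlySupportedContinuousMap (cmDatum L 3 H).Adelic ℂ
/-- `C_c(G(𝔸))`, `G = U(Φ₃)` (T1's `TestG`). -/
abbrev TestG : Type := CompactlySupportedContinuousMap (cmDatum L 3 (splitForm L 3)).Adelic ℂ
/-- `C_c(H(𝔸))`, `H = U(Φ₂) × U(Φ₁)` (T1's `TestH`). -/
abbrev TestH : Type :=
  CompactlySupportedContinuousMap ((cmDatum L 2 (splitForm L 2)).Adelic × (cmDatum L 1 (splitForm L 1)).Adelic) ℂ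

/-- Finite places of `L⁺`. -/
abbrev Places : Type := HeightOneSpectrum (𝓞 ↥(maximalRealSubfield L))

example (H : Matrix (Fin 3) (Fin 3) L) : cmDatum L 3 H = Gp L H := rfl

variable (H : Matrix (Fin 3) (Fin 3) L)

/-- **E.V.P. DATA (D9, concrete)** [Rogawski1990 §13.7 p. 206 «`t = (t_v)`»; CartierCorvallis1979 §IV.1 Cor. 4.1]: a family, over the finite places `v`
of `L⁺`, of linear functionals on test functions of `G′_v` — at an unramified `v` the eigencharacter `t_v` of `ℋ(G′_v, K_v)` in the currency of
★ p816113 `IrrClass.IsSphericalWith c K_v μ_v t_v` (values at ramified `v` are never read: all comparisons are `EqOff S`). -/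
abbrev EvpData : Type := ∀ v : Places L, (((cmDatum L 3 H).Local v) → ℂ) → ℂ

/-- `t = t′` as e.v.p.'s AWAY FROM `S` [§13.7 p. 206: «`t_S`»]. -/
def EqOff (S : Finset (Places L)) (t t' : EvpData L H) : Prop := ∀ v : Places L, v ∉ S → t v = t' v

/-- `EqOff` is reflexive. [cite: Rogawski1990, §13.7 p. 206] -/
theorem EqOff.rfl' (S : Finset (Places L)) (t : EvpData L H) : EqOff L H S t t := fun _ _ => rfl

/-- `EqOff` is symmetric. [cite: Rogawski1990, §13.7 p. 206] -/
theorem EqOff.symm' {S : Finset (Places L)} {t t' : EvpData L H} (h : EqOff L H S t t') : EqOff L H S t' t := fun v hv => (h v hv).symm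

/-- `EqOff` is transitive. [cite: Rogawski1990, §13.7 p. 206] -/
theorem EqOff.trans' {S : Finset (Places L)} {t t' t'' : EvpData L H} (h : EqOff L H S t t') (h' : EqOff L H S t' t'') : EqOff L H S t t'' :=
  fun v hv => (h v hv).trans (h' v hv)

/-- `EqOff` is monotone in `S`: equal off `S` ⇒ equal off any `S′ ⊇ S`. [cite: Rogawski1990, §13.7 p. 206] -/
theorem EqOff.mono {S S' : Finset (Places L)} (hSS' : S ⊆ S') {t t' : EvpData L H} (h : EqOff L H S t t') : EqOff L H S' t t' :=
  fun v hv => h v fun hv' => hv (hSS' hv')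

/-- The setoid «equal off `S`». -/
def eqOffSetoid (S : Finset (Places L)) : Setoid (EvpData L H) where
  r := EqOff L H S
  iseqv := ⟨EqOff.rfl' L H S, EqOff.symm' L H, EqOff.trans' L H⟩

/-- **Germs of e.v.p.'s off `S`** — print's «e.v.p. `t_S = (t_v)_{v ∉ S}`» [§13.7 p. 206]: the index of (14.6.2). -/
abbrev Germ (S : Finset (Places L)) : Type := Quotient (eqOffSetoid L H S)

/-- The germ of an e.v.p. off `S`. -/
abbrev germ (S : Finset (Places L)) (t : EvpData L H) : Germ L H S := Quotient.mk (eqOffSetoid L H S) t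

/-- Two e.v.p.'s have the same germ off `S` iff they are equal off `S`. [cite: Rogawski1990, §13.7 p. 206] -/
theorem germ_eq_germ_iff (S : Finset (Places L)) (t t' : EvpData L H) : germ L H S t = germ L H S t' ↔ EqOff L H S t t' :=
  Quotient.eq (r := eqOffSetoid L H S)

section Token

variable (ι : L →+* ℂ) (T : GL (Fin 3) ℂ)
  (hT : (T : Matrix (Fin 3) (Fin 3) ℂ)ᴴ * H.map ι * (T : Matrix (Fin 3) (Fin 3) ℂ) = Literature.Geometry.ComplexHyperbolic.BallModel.J)
  (μ : Measure (Gp L H).automorphicQuotient) [(Gp L H).IsAutomorphicMeasure μ]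

/-- An `H¹`-TOKEN of `P` at `ι` into the irreducible `(𝔤, K)`-module `(M, σK, σ𝔤)` — the binder text of (C2)∕(C3) of ★ p814159, named. -/
def HasToken (P : DiscreteAutomorphicRep (Gp L H) μ) (M : Type) [AddCommGroup M] [Module ℂ M]
    (σK : Representation ℂ (uFormGroup (Fin 2) (Fin 1)).maximalCompact M) (σ𝔤 : (uFormGroup (Fin 2) (Fin 1)).lie →ₗ⁅ℝ⁆ Module.End ℂ M) : Prop :=
  ∃ T₁ : P.archModuleCM ι T hT →ₗ[ℂ] M,
    (∀ (k : (uFormGroup (Fin 2) (Fin 1)).maximalCompact) (w : P.archModuleCM ι T hT), T₁ (P.archRepKCM ι T hT k w) = σK k (T₁ w)) ∧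
      (∀ (X : (uFormGroup (Fin 2) (Fin 1)).lie) (w : P.archModuleCM ι T hT), T₁ (P.archRepLieCM ι T hT X w) = σ𝔤 X (T₁ w)) ∧ T₁ ≠ 0

/-- **A discrete `P` occurs in `L²`**: `1 ≤ m(P)` (★ `le_multiplicity_of_pairwise_isOrtho` on the one-member family `{P.space}`). -/
theorem one_le_multiplicity (P : DiscreteAutomorphicRep (Gp L H) μ) : (1 : ℕ∞) ≤ ((Gp L H).rightRegular μ).multiplicity P.space.toContRep := by
  have h := ContRepresentation.le_multiplicity_of_pairwise_isOrtho (π := (Gp L H).rightRegular μ) (W := fun _ : Unit => P.space)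
    (fun _ => P.irreducible) (fun i j hij => absurd (Subsingleton.elim i j) hij) (σ := P.space.toContRep) Finset.univ
    (fun _ _ => ContRepresentation.AreUnitarilyEquivalent.refl _)
  simpa using h

end Token

/-! ## §1 The classification kit — POSITED carriers of pp. 236–239 (DATA ONLY; nothing asserted) -/

/-- **The archimedean class type** (v3, D8-c revisited): isomorphism classes of irreducible `(𝔤,K)`-modules of `U(2,1)` = ★ `GKIrrClass (uFormGroup (Fin 2) (Fin 1))`
(typ3 p816930; the carrier of the letters' token binders `σK`, `σ𝔤` — p04 (g6) census 08:38:22Z).  No longer a posited field. -/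
abbrev Cinf : Type 1 := GKIrrClass (uFormGroup (Fin 2) (Fin 1))

/-- **T1's SOCKETS** (v3; p04 (g6) census `CENSUS-T1-T5-socket-bridge` 3aa3fb5e): the nine data of (14.6.1) that a T5 kit READS from P3a's `ComparisonKit`
— `Tr ρ_d`, smoothness, the global packets of `G` and `H` with their coefficients and traces, and the matching relation.  Carrier types are T1-name-free
(plain function types over the shared frame abbreviations), so the bridge `Sockets.ofT1 𝔨 := ⟨𝔨.traceGp, …, 𝔨.Matches⟩` lives in the LINE file and the law
`TraceIdentity` at such a kit is T1's head `InnerFormStableTraceIdentity` by `Iff.rfl`. -/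
structure Sockets (μ : Measure (Gp L H).automorphicQuotient) [(Gp L H).IsAutomorphicMeasure μ] where
  traceGp : TestGp L H →ₗ[ℂ] ℂ
  Smooth : TestGp L H → Prop
  PacketG : Type
  PacketH : Type
  nG : PacketG → ℂ
  nH : PacketH → ℂ
  trG : PacketG → TestG L → ℂ
  trH : PacketH → TestH L → ℂ
  Matches : TestGp L H → TestG L → TestH L → Prop

/-- **Classification kit for `G′ = U(H)` at the frame `(ι, T, hT)`** [Rogawski1990, §13.7 p. 206; §14.6 pp. 236–239].  Fields ↦ print:
`Cls, cl, mult, ramCls` = the classes of discrete `π′`, `m(π′)`, their ramification [§14.5 p. 237] · `evp` = the e.v.p. of a class (D9, CONCRETE `EvpData`; pinned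
by `IsPinned` (ii) over ★ `IrrClass.IsSphericalWith`) · `clFin, clInf, cl0` = local coordinates (finite `v`: ★ `IrrClass`; the real place under `ι`: `Cinf` —
D8-c POSITED, arch traces AXIOMATISED not constructed; the compact real places: `C0`) · `UnitaryLoc` = «every coordinate unitary» (posited predicate; Prop. 13.8.1
needs it) · `μv` = Haar measures on `G′_v` · `TestS, Unr, tens, hat, chS` = `f′ = f′_{S,∞} ⊗ f^S`, `f^S ↦ f^{S∧}(t)` on the unramified Hecke algebra, and the character
of an irreducible of `G′_{S ∪ ∞}` (pin road: ★ `UnitaryGroup.PureTensor.toCc`) · `traceGp, Smooth, Matches, PacketG/H, nG/H, trG/H` = T1's sockets (14.6.1) · `TestSG/SH,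
tensG/H, trGS/HS, MatchesS, evpG/H, ramG/H` = the same factorisation on `G` and `H` (with `ψ_v`, the fundamental-lemma map `b` off `S`, and `ξ_H` on e.v.p.'s [§13.2]) ·
`ram, tXi, PiXi, ρXi, sgnG, N, packInf, F0, packFin, sgnInf, infCls` = the A-packet data of `ξ` [§13.1; §12.3; §14.4; (14.6.3)]. -/
structure ClassificationKit (ι : L →+* ℂ) (T : GL (Fin 3) ℂ)
    (hT : (T : Matrix (Fin 3) (Fin 3) ℂ)ᴴ * H.map ι * (T : Matrix (Fin 3) (Fin 3) ℂ) = Literature.Geometry.ComplexHyperbolic.BallModel.J)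
    (μ : Measure (Gp L H).automorphicQuotient) [(Gp L H).IsAutomorphicMeasure μ] extends Sockets L H μ where
  Cls : Type
  cl : DiscreteAutomorphicRep (Gp L H) μ → Cls
  mult : Cls → ℕ
  ramCls : Cls → Finset (Places L)
  evp : Cls → EvpData L H
  C0 : Type
  clFin : Cls → ∀ v : Places L, IrrClass ((cmDatum L 3 H).Local v)
  clInf : Cls → Cinf
  cl0 : Cls → C0
  UnitaryLoc : ∀ S : Finset (Places L), Cinf × C0 × (∀ v : ↥S, IrrClass ((cmDatum L 3 H).Local v.1)) → Prop
  μv : ∀ v : Places L, @Measure ((cmDatum L 3 H).Local v) (borel _)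
  TestS : Finset (Places L) → Type
  Unr : Finset (Places L) → Type
  tens : ∀ S, TestS S → Unr S → TestGp L H
  hat : ∀ S, Germ L H S → Unr S → ℂ
  trGp : Cls → TestGp L H → ℂ
  chS : ∀ S : Finset (Places L), Cinf × C0 × (∀ v : ↥S, IrrClass ((cmDatum L 3 H).Local v.1)) → TestS S → ℂ
  evpG : PacketG → EvpData L H
  evpH : PacketH → EvpData L H
  ramG : PacketG → Finset (Places L)
  ramH : PacketH → Finset (Places L)
  TestSG : Finset (Places L) → Type
  TestSH : Finset (Places L) → Type
  tensG : ∀ S, TestSG S → Unr S → TestG L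
  tensH : ∀ S, TestSH S → Unr S → TestH L
  trGS : ∀ S, PacketG → TestSG S → ℂ
  trHS : ∀ S, PacketH → TestSH S → ℂ
  MatchesS : ∀ S, TestS S → TestSG S → TestSH S → Prop
  ram : OneDimAutRepH L → Finset (Places L)
  tXi : OneDimAutRepH L → EvpData L H
  PiXi : OneDimAutRepH L → PacketG
  ρXi : OneDimAutRepH L → PacketH
  sgnG : OneDimAutRepH L → ℚ
  N : OneDimAutRepH L → ℕ
  packInf : OneDimAutRepH L → LocalAPacket Cinf
  F0 : OneDimAutRepH L → Option C0
  packFin : OneDimAutRepH L → ∀ v : Places L, CMLocalAPacket L H v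
  sgnInf : OneDimAutRepH L → ℤ

namespace ClassificationKit

variable {L H} {ι : L →+* ℂ} {T : GL (Fin 3) ℂ}
  {hT : (T : Matrix (Fin 3) (Fin 3) ℂ)ᴴ * H.map ι * (T : Matrix (Fin 3) (Fin 3) ℂ) = Literature.Geometry.ComplexHyperbolic.BallModel.J}
  {μ : Measure (Gp L H).automorphicQuotient} [(Gp L H).IsAutomorphicMeasure μ] (𝔠 : ClassificationKit L H ι T hT μ)

/-! ### §1.1 Derived notation -/

/-- The `S ∪ ∞`-coordinates of an irreducible of `G′(𝔸)`: archimedean class at `ι`, class at the compact real places, classes at `v ∈ S`. -/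
abbrev LocS (S : Finset (Places L)) : Type 1 := Cinf × 𝔠.C0 × (∀ v : ↥S, IrrClass ((cmDatum L 3 H).Local v.1))

/-- The coordinates of a class. -/
def coordS (S : Finset (Places L)) (c : 𝔠.Cls) : 𝔠.LocS S := (𝔠.clInf c, 𝔠.cl0 c, fun v => 𝔠.clFin c v.1)

/-- The coefficient of a class `x` in `Tr πⁿ + ε Tr πˢ` for a local packet [p. 238 ll. 11–18]: `1` at `πⁿ`, `ε` at `πˢ`, `0` elsewhere. -/
def memberCoeff {C : Type*} (Pk : LocalAPacket C) (ε : ℚ) (x : C) : ℚ :=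
  if x = Pk.πn then 1 else if Pk.πs = some x then ε else 0

/-- **The expansion coefficients of (14.6.3)** [p. 238 ll. 11–18]: at coordinates `(x_∞, x₀, (x_v)_{v ∈ S})`,
`E_ξ = [x₀ = F₀(ξ)] · ½(−1)^N · (∏ coeff⁻ + c(ξ) ∏ coeff⁺)`, products over `ι` and `v ∈ S`. -/
def expansion (ξ : OneDimAutRepH L) (S : Finset (Places L)) (x : 𝔠.LocS S) : ℚ :=
  (if 𝔠.F0 ξ = some x.2.1 then 1 else 0) * (1 / 2) * (-1) ^ 𝔠.N ξ *
    (memberCoeff (𝔠.packInf ξ) (-1) x.1 * ∏ v : ↥S, memberCoeff (𝔠.packFin ξ v.1) (-1) (x.2.2 v) +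
      𝔠.sgnG ξ * (memberCoeff (𝔠.packInf ξ) 1 x.1 * ∏ v : ↥S, memberCoeff (𝔠.packFin ξ v.1) 1 (x.2.2 v)))

/-! ### §1.2 Pins — ANCHORS to ★ data of the actual `P` (further anchors are APPENDED in later editions, T1 discipline) -/

/-- **`IsPinned`** (v0): (i) `mult (cl P)` IS the multiplicity of `P` in `L²` [§14.5 p. 237] (= T1 pin (ii); the ONLY place `rightRegular` enters a hypothesis);
(ii) **D9 PIN** — off `ramCls c` the class `clFin c v` is `K_v`-SPHERICAL WITH EIGENCHARACTER `evp c v` in ★ p816113's currency (`K_v` = ★ `cmLocalIntegralLevel`)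
[CartierCorvallis1979 §IV.1 Cor. 4.1; Rogawski1990 §13.7 p. 206]; (iii) `μv v` is a Haar measure on `G′_v`; (iv) the finite coordinates `clFin c v` are
ADMISSIBLE classes OFF `ramCls c` (RULINGS (V11)(i), (V24)(d3)) and (v) UNITARIZABLE classes OFF `ramCls c` (RULINGS (V18), (V24)(d3); (UN); at `v ∈ S` admissibility ∕
unitarity of the coordinates is law `UnitaryCoord`); (vi) the e.v.p. `evp c v` takes the JUNK VALUE `0` off the spherical
Hecke algebra `C_c(K_v\G_v/K_v)` (one convention for every e.v.p. field — law `EvpConvention` for the packet side; F0P4-p02 (g6) memo d1f38a39 (H-b));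
(vii) `hat S g f^S` FACTORISES as the finite product `∏_{v ∈ T} t_v(f_v)` of local eigencharacter values at spherical Hecke functions over a finite `T`
disjoint from `S`, for any representative `t` of `g`, and (viii) conversely every such finite family off `S` is carried by some `f^S ∈ Unr S` — (vii)+(viii)
pin the posited `Unr S`∕`hat` to the restricted tensor product `⊗′_{v∉S} ℋ(G′_v, K_v)` up to `hat`-equivalence, so that the (L1) laws become THEOREMS
kit-parametrically (`hatBounded_cls_of_pins` below; (L1-i)∕(L1-iii) likewise). -/
def IsPinned : Prop :=
  (∀ P : DiscreteAutomorphicRep (Gp L H) μ, ((𝔠.mult (𝔠.cl P) : ℕ) : ℕ∞) = ((Gp L H).rightRegular μ).multiplicity P.space.toContRep) ∧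
  (∀ (c : 𝔠.Cls) (v : Places L), v ∉ 𝔠.ramCls c →
    letI : MeasurableSpace ((cmDatum L 3 H).Local v) := borel _
    (𝔠.clFin c v).IsSphericalWith (cmLocalIntegralLevel L 3 H v) (𝔠.μv v) (𝔠.evp c v)) ∧
  (∀ v : Places L,
    letI : MeasurableSpace ((cmDatum L 3 H).Local v) := borel _
    (𝔠.μv v).IsHaarMeasure) ∧
  -- (iv) ADMISSIBILITY of the finite coordinates OFF `ramCls c` (RULINGS (V11)(i), (V24)(d3)) [Flath1979 Thm. 3; BernsteinZelevinsky1976 §2; local constituents of automorphic `P` are admissible]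
  (∀ (c : 𝔠.Cls) (v : Places L), v ∉ 𝔠.ramCls c → (𝔠.clFin c v).IsAdmissible) ∧
  -- (v) UNITARITY of the finite coordinates OFF `ramCls c` (RULINGS (V18), (V24)(d3); anchor (UN) ★ `F0P3LocalConstituentsUnitary` + ★ p816767) [Rogawski1990 §14.5 p. 237]
  (∀ (c : 𝔠.Cls) (v : Places L), v ∉ 𝔠.ramCls c → (𝔠.clFin c v).IsUnitarizable) ∧
  -- (vi) JUNK CONVENTION for e.v.p.'s of classes: value `0` off the spherical Hecke algebra `C_c(K_v\G_v/K_v)` (RULING (V18), (H-b))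
  (∀ (c : 𝔠.Cls) (v : Places L) (f : (cmDatum L 3 H).Local v → ℂ),
    ¬ (HasCompactSupport f ∧ IsLevel (cmLocalIntegralLevel L 3 H v) f) → 𝔠.evp c v f = 0) ∧
  -- (vii) `hat` FACTORISES: `f^{S∧}(t) = ∏_{v ∈ T} t_v(f_v)` over a finite set `T` of places off `S` with `f_v ∈ C_c(K_v\G_v/K_v)` [Rogawski1990 §13.7 p. 206; CartierCorvallis1979 §IV.1]
  (∀ (S : Finset (Places L)) (fT : 𝔠.Unr S), ∃ T : Finset (Places L), Disjoint T S ∧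
    ∃ f : ∀ v : Places L, (cmDatum L 3 H).Local v → ℂ,
      (∀ v ∈ T, HasCompactSupport (f v) ∧ IsLevel (cmLocalIntegralLevel L 3 H v) (f v)) ∧
      ∀ t : EvpData L H, 𝔠.hat S (germ L H S t) fT = ∏ v ∈ T, t v (f v)) ∧
  -- (viii) `Unr S` IS RICH: every finite family of spherical Hecke functions off `S` is the factor family of some `f^S` [CartierCorvallis1979 §IV.1]
  (∀ (S T : Finset (Places L)), Disjoint T S → ∀ f : ∀ v : Places L, (cmDatum L 3 H).Local v → ℂ,
    (∀ v ∈ T, HasCompactSupport (f v) ∧ IsLevel (cmLocalIntegralLevel L 3 H v) (f v)) →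
    ∃ fT : 𝔠.Unr S, ∀ t : EvpData L H, 𝔠.hat S (germ L H S t) fT = ∏ v ∈ T, t v (f v))

end ClassificationKit

end Summit.HodgeConjecture.HodgeConjecture.Cruxes.H413.F0P3InnerFormClassification
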